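import Summits.Ventures.Crystal3D.LocalLP.SurfaceComposition
import HarnessLib

/-!
# Kissing saturation at probing radius `1` is a theorem: `SaturationInput 1`

HONEST FRAMING. Part of the venture `Summits/Ventures/Crystal3D` (cell `pub-crystal3d`). This file
DISCHARGES, unconditionally, the named input `(K)` of `LocalLP/SurfaceComposition.lean` at
probing radius `1` (= Bezdek's radius-`2` sphere around radius-`1` balls): a ball with twelve
contacts has NO exposed direction at radius `1` — its exposed cap is empty, so its exposed
fraction is `0`. Proof: an exposed direction `u` gives the point `x i + u` at distance `1` from
`x i` and at distance `≥ 1` from the twelve contact neighbours, i.e. thirteen unit vectors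
(`u` and the `x j - x i`) pairwise at distance `≥ 1`, contradicting the tree's kissing-number
theorem `musin2006_kissing_three_holds`. Consequently the headline `H1` needs only the inputs
`(L)` and `(I)`. (At smaller probing radii, e.g. H2's `1783/2000`, saturation needs Hales's
twelve-neighbour gap `2.52` and stays an input.) No crystallization statement is claimed.
-/

noncomputable section

open scoped BigOperators
open Finset

namespace Summit.Ventures.Crystal3D

open Literature.Geometry.DiscreteGeometry (musin2006_kissing_three_holds ballFraction)

variable {N : ℕ} {x : Fin N → EuclideanSpace ℝ (Fin 3)}

/-- **Twelve contacts leave no exposed direction at radius `1`.** -/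
theorem exposedCap_one_eq_empty (hx : IsUnitPacking x) (i : Fin N) (h12 : coordination x i = 12) :
    exposedCap x 1 i = ∅ := by
  classical
  ext u
  simp only [exposedCap, one_smul, Set.mem_setOf_eq, Set.mem_empty_iff_false, iff_false, not_and]
  intro hu hfar
  -- the twelve contact directions
  set S : Finset (EuclideanSpace ℝ (Fin 3)) := (contactNeighbors x i).image fun j => x j - x i
    with hS
  have hinj : Set.InjOn (fun j => x j - x i) ↑(contactNeighbors x i) :=
    fun j _ k _ h => hx.injective (sub_left_injective h)
  have hScard : S.card = 12 := by
    rw [hS, card_image_of_injOn hinj]; exact h12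
  -- `u` is not one of them (it is far from every other centre)
  have huS : u ∉ S := by
    intro h
    obtain ⟨j, hj, hju⟩ := mem_image.1 h
    have hji : j ≠ i := ((mem_contactNeighbors x).1 hj).1
    have h1 := hfar j hji
    rw [← hju, add_sub_cancel, dist_self] at h1
    exact absurd h1 (by norm_num)
  have hT : (insert u S).card = 13 := by
    rw [card_insert_of_notMem huS, hScard]
  -- thirteen unit vectors pairwise at distance ≥ 1: impossible
  have h13 := musin2006_kissing_three_holds (insert u S) ?_ ?_
  · omega
  · intro v hv
    rcases mem_insert.1 hv with rfl | hv
    · exact hu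
    · obtain ⟨j, hj, rfl⟩ := mem_image.1 hv
      rw [← dist_eq_norm, dist_comm]
      exact ((mem_contactNeighbors x).1 hj).2
  · -- pairwise separation
    have key : ∀ v ∈ S, 1 ≤ dist u v := by
      intro v hv
      obtain ⟨j, hj, rfl⟩ := mem_image.1 hv
      have hji : j ≠ i := ((mem_contactNeighbors x).1 hj).1
      have h1 := hfar j hji
      have : dist u (x j - x i) = dist (x i + u) (x j) := by
        rw [dist_eq_norm, dist_eq_norm]
        congr 1
        abel
      rw [this]; exact h1
    intro v hv w hw hvw
    rcases mem_insert.1 hv with hv' | hv'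
    · rcases mem_insert.1 hw with hw' | hw'
      · exact absurd (hv'.trans hw'.symm) hvw
      · rw [hv']; exact key w hw'
    · rcases mem_insert.1 hw with hw' | hw'
      · rw [hw', dist_comm]; exact key v hv'
      · obtain ⟨j, hj, rfl⟩ := mem_image.1 hv'
        obtain ⟨k, hk, rfl⟩ := mem_image.1 hw'
        have hjk : j ≠ k := fun h => hvw (by rw [h])
        rw [dist_eq_norm, sub_sub_sub_cancel_right, ← dist_eq_norm]
        exact hx hjk

/-- An empty set of directions has exposed fraction `0` (volume fraction of the empty cone). -/
theorem ballFraction_rayCone_empty :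
    ballFraction (0 : EuclideanSpace ℝ (Fin 3))
      {v : EuclideanSpace ℝ (Fin 3) | v ≠ 0 ∧ ‖v‖⁻¹ • v ∈ (∅ : Set (EuclideanSpace ℝ (Fin 3)))}
      = 0 := by
  simp [ballFraction]

/-- **`(K)` at radius `1` is a theorem**: in every packing of diameter-`1` balls in `ℝ³`, a ball
with twelve contacts has exposed fraction `0` at probing radius `1` (kissing number twelve). -/
theorem saturationInput_one : SaturationInput 1 := by
  intro N x hx i h12
  unfold exposedFraction
  rw [exposedCap_one_eq_empty hx i h12]
  exact ballFraction_rayCone_empty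

end Summit.Ventures.Crystal3D

end
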